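import Literature.MathematicalPhysics.QuantumLattice.HeisenbergWindowCertificateSquare
import HarnessLib

/-!
# Heisenberg window certificates with PER-TERM regions (literal instance shape of a reduce-mode
# certificate; the support-box torus threshold)

Cell pub-mbboot (bundle `papers/HubbardSuperconductivity/manybody-bootstrap/`, HOME `run/shared/lean/pub/pub-mbboot/`).
HONEST FRAMING: certified numerical bounds on a lattice model; not superconductivity, not a phase diagram.

Companion of `WindowCertificateFamilies` (Hubbard, square lattice) for the spin-`n/2` Heisenberg
model. The tree's soundness theorems for Heisenberg window certificates,
`Literature.MathematicalPhysics.QuantumLattice.heisenbergTorus_groundEnergy_ge_of_window_certificate_perm`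
(every `d`, workhorse) and `heisenbergSquare_groundEnergy(_div)_ge_of_window_certificate_d4` (`d = 2`,
affine `D₄` reductions; Han, arXiv:2006.06002 §2–3, certified form), carry ONE inner region `Λ ⊆ Λ'`
for every equation-of-motion word `Bₖ` (closure `Λ ± eᵢ ⊆ Λ'`) and every symmetry word `Yₗ`
(`γₗ Λ + wₗ ⊆ Λ'` for all `l`). A reduce-mode certificate of the cell (format `certsdp/1`) re-expressed
with in-class representatives inside its support box `B'` (`HOME/certs/sdp1/SUPPORT-BOX.md`) has a
different region for every term, and no single `Λ` serves all terms when `Λ' = B'`. This file proves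
the same theorems with PER-TERM regions, by the same proofs:

* `heisenbergTorus_groundEnergy_ge_of_window_certificate_perm_families` — every `d`, symmetry family
  by torus automorphisms (as the tree's workhorse), `Bₖ ∈ 𝔄(Λᴮₖ)` with `Λᴮₖ ⊆ Λ'`, `Λᴮₖ ± eᵢ ⊆ Λ'`;
* `heisenbergSquare_groundEnergy_ge_of_window_certificate_d4_families` and its per-site form
  `heisenbergSquare_groundEnergy_div_ge_of_window_certificate_d4_families` — `d = 2`, affine `D₄`
  words `Yₗ ∈ 𝔄(Λʸₗ)`, `Λʸₗ ⊆ Λ'`, `γₗ Λʸₗ + wₗ ⊆ Λ'`: for every `L ≥ 3` with `x ↦ x mod L` injective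
  on `Λ'`, `c − Σₖ ‖aₖ‖ ≤ groundEnergy (heisenbergHamiltonian n (torusGraph 2 L) J) / L²`;
* `heisenbergSquare_groundEnergy_div_ge_of_window_certificate_d4_families_of_spread` — the
  injectivity hypothesis replaced by the finite check "all coordinate spreads of `Λ'` are `≤ M`" and
  `L ≥ M + 1` (with `L ≥ 3`); for `Λ' = B'` of side `D'` (`M = D' − 1`) this is `L ≥ max(3, D')`, so the
  threshold `L ≥ D' + 2` used uniformly in `SUPPORT-BOX.md` (`torus_min_L_tree`) holds a fortiori.

Dictionary with a certificate file (the file ⇒ identity step is checked by the cell's verifiers A/B/C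
in exact arithmetic, NOT by the kernel — unchanged here): `Λ' := B'`; `O`, `V`, `W`, `M` words of
`𝔄(B')`; `Λᴮₖ := supp(eom word k)`; for every identified pair `αₗ = Γ(gₗ) βₗ` with the in-class
representative `βₗ` a monomial of the file, `Λʸₗ := supp(βₗ)`, `Yₗ := p_{αₗ} βₗ`, `(γₗ, wₗ) := gₗ`
(`γₗ Λʸₗ + wₗ = supp(αₗ) ⊆ B'`). No certificate instance is kernel-checked here.

New mathematics of this cell only in the weak sense of a re-binding of tree theorems (no published
source states it; method source Han 2020 §2–3): placed under the cell topic
`Summits/HubbardSuperconductivity/ManyBodyBootstrap/` by the cell's placement rule, namespace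
`Summit.HubbardSuperconductivity.ManyBodyBootstrap`.

## References
* X. Han, *Quantum many-body bootstrap*, arXiv:2006.06002 (2020), §2 eq. (2), §3. (bib: Han2020Bootstrap)
* Tree: `Literature/MathematicalPhysics/QuantumLattice/HeisenbergWindowCertificateSquare.lean`
  (`heisenbergTorus_groundEnergy_ge_of_window_certificate_perm`, `spinEmbed_toTorus_d4_sub`,
  `torusGraph_adj_torusD4Aff`), `HeisenbergWindowCertificate.lean` (`heisenbergTorus_commutator_spinEmbed`),
  `SymmetricLocalCertificate.lean` (`Matrix.mul_card_le_minEnergyOn_of_local_certificate`).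
-/

noncomputable section

namespace Summit.HubbardSuperconductivity.ManyBodyBootstrap

open Matrix Finset
open Literature.MathematicalPhysics.QuantumLattice
open Literature.Probability.LatticeModels
open Literature.MathematicalPhysics.QuantumManyBody.StateRelaxation
open scoped ComplexOrder BigOperators

/-! ### Workhorse: every `d`, per-term equation-of-motion regions -/

section Workhorse

variable {d L : ℕ} [NeZero L]

/-- **Window certificate ⇒ ground-state energy of every large Heisenberg torus `(ℤ/Lℤ)^d`, per-term
equation-of-motion regions.** As the tree's
`heisenbergTorus_groundEnergy_ge_of_window_certificate_perm`, but every word `Bₖ` lives on its own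
region `Λᴮₖ ⊆ Λ'` with `Λᴮₖ ± eᵢ ⊆ Λ'`: the window identity
`J Σᵢ 𝐒_0·𝐒_{eᵢ} − c·1 = Σ Λₐᵦ Oₐᴴ O_b + (Σₖ (H_{Λ'} Γ(incl)Bₖ − Γ(incl)Bₖ H_{Λ'}) + Σₗ Dₗ + Σⱼ bⱼ • Wⱼ)
   + (Σₘ dₘ • (Vₘᴴ − Vₘ) + Σₖ aₖ • Mₖ)`
(window terms `Dₗ` pulling back to symmetry defects `P_{eₗ} Yₗ P_{eₗ}ᴴ − Yₗ` of torus automorphisms,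
`S^z`-charged `Wⱼ`, real `dₘ`, contractions `Mₖ`) gives `(c − Σₖ ‖aₖ‖) · L^d ≤ E₀(H_L)` for every
`L ≥ 3` with `x ↦ x mod L` injective on `Λ'`. Same proof as the tree theorem (Han 2020 §2, certified
form); only the binders differ. -/
theorem heisenbergTorus_groundEnergy_ge_of_window_certificate_perm_families (n : ℕ) (J : ℝ) (hL : 3 ≤ L)
    {Λ' : Finset (Site d)}
    (hz : (0 : Site d) ∈ Λ') (he : ∀ i : Fin d, (unitVec i : Site d) ∈ Λ')
    (hInj : Set.InjOn (Torus.proj (d := d) L) ↑Λ')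
    {m : Type*} [Fintype m] [DecidableEq m] {Λm : Matrix m m ℂ} (hΛm : Λm.PosSemidef)
    (O : m → Op ↥Λ' (n + 1))
    {κ : Type*} (s : Finset κ) (ΛB : κ → Finset (Site d)) (hB : ∀ k, ΛB k ⊆ Λ')
    (hclosedB : ∀ k, ∀ x ∈ ΛB k, ∀ i : Fin d, x + unitVec i ∈ Λ' ∧ x - unitVec i ∈ Λ')
    (B : (k : κ) → Op ↥(ΛB k) (n + 1))
    {ι : Type*} (tt : Finset ι) (e : ι → Equiv.Perm (TorusSite d L))
    (hadj : ∀ l ∈ tt, ∀ x y, (torusGraph d L).Adj (e l x) (e l y) ↔ (torusGraph d L).Adj x y)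
    (D : ι → Op ↥Λ' (n + 1)) (Yt : ι → Op (TorusSite d L) (n + 1))
    (hD : ∀ l ∈ tt, spinEmbed (spinToTorusEmb L hInj) (D l) =
      permOp (e l) * Yt l * (permOp (e l))ᴴ - Yt l)
    {ρ : Type*} (u : Finset ρ) (b : ρ → ℂ) (W : ρ → Op ↥Λ' (n + 1)) (mq : ρ → ℂ)
    (hmq : ∀ j ∈ u, mq j ≠ 0)
    (hW : ∀ j ∈ u, totalSpin n 2 * W j - W j * totalSpin n 2 = mq j • W j)
    {δ : Type*} (ah : Finset δ) (dc : δ → ℝ) (V : δ → Op ↥Λ' (n + 1))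
    {κ'' : Type*} (w : Finset κ'') (a : κ'' → ℂ) (M : κ'' → Op ↥Λ' (n + 1))
    (hM : ∀ k ∈ w, (M k).IsContraction) {c : ℝ}
    (hcert : (J : ℂ) • (∑ i : Fin d, spinDot n (⟨0, hz⟩ : ↥Λ') ⟨unitVec i, he i⟩) -
        (c : ℂ) • (1 : Op ↥Λ' (n + 1)) =
      gramForm Λm O +
        (∑ k ∈ s, (heisenbergHamiltonian n (windowGraph Λ') J * spinEmbed (siteIncl (hB k)) (B k) -
            spinEmbed (siteIncl (hB k)) (B k) * heisenbergHamiltonian n (windowGraph Λ') J) +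
          ∑ l ∈ tt, D l +
          ∑ j ∈ u, b j • W j) +
        (∑ m' ∈ ah, ((dc m' : ℝ) : ℂ) • ((V m')ᴴ - V m') + ∑ k ∈ w, a k • M k)) :
    (c - ∑ k ∈ w, ‖a k‖) * (L : ℝ) ^ d ≤ (heisenbergHamiltonian n (torusGraph d L) J).groundEnergy := by
  classical
  set Γ' := spinEmbed (q := n + 1) (spinToTorusEmb L hInj) with hΓ'
  set H := heisenbergHamiltonian n (torusGraph d L) J with hH
  have hHh : H.IsHermitian := heisenbergHamiltonian_isHermitian n _ J
  set X := Γ' ((J : ℂ) • ∑ i : Fin d, spinDot n (⟨0, hz⟩ : ↥Λ') ⟨unitVec i, he i⟩) with hX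
  have hXe : X = (J : ℂ) • ∑ i : Fin d,
      spinDot n (Torus.proj L (0 : Site d)) (Torus.proj L (unitVec i : Site d)) := by
    rw [hX, map_smul, map_sum]
    refine congrArg _ (Finset.sum_congr rfl fun i _ => ?_)
    rw [hΓ', spinEmbed_spinDot, spinToTorusEmb_apply, spinToTorusEmb_apply]
  -- translations and the per-site decomposition
  set T : TorusSite d L → Op (TorusSite d L) (n + 1) := fun v' => permOp (torusAff 1 v') with hT
  have hTH : ∀ v', T v' * H = H * T v' := fun v' => permOp_torusAff_mul_heisenbergHamiltonian n 1 v' J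
  have hTT : ∀ v', (T v')ᴴ * T v' = 1 := fun v' => conjTranspose_permOp_mul _
  have hsum : ∑ v', T v' * X * (T v')ᴴ = H := by
    have hdec := sum_permOp_conj_spinDotStar (d := d) (L := L) n hL
    rw [hH, heisenbergHamiltonian_eq_smul_one n (torusGraph d L) J, ← hdec, Finset.smul_sum]
    refine Finset.sum_congr rfl fun v' _ => ?_
    rw [hT, hXe]
    simp only [Matrix.mul_smul, Matrix.smul_mul]
  -- the sector is the whole space
  have hK : (⊤ : Submodule ℂ (TensorIndex (TorusSite d L) (n + 1) → ℂ)) ≠ ⊥ := top_ne_bot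
  -- symmetry family
  set Us : ι → Op (TorusSite d L) (n + 1) := fun l => permOp (e l) with hUs
  have hU : ∀ l ∈ tt, Us l * H = H * Us l := fun l hl =>
    (permOp_mul_eq_mul_permOp_iff _ _).2 (reindexOp_heisenbergHamiltonian n _ _ (e l) (hadj l hl) J)
  have hUU : ∀ l ∈ tt, (Us l)ᴴ * Us l = 1 := fun l _ => conjTranspose_permOp_mul _
  -- charge family
  set C : ρ → Op (TorusSite d L) (n + 1) := fun _ => totalSpin n 2 with hC
  set Wt : ρ → Op (TorusSite d L) (n + 1) := fun j => (b j / mq j) • Γ' (W j) with hWt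
  have hCH : ∀ j ∈ u, C j * H = H * C j := fun _ _ =>
    (commute_heisenbergHamiltonian_totalSpin n (torusGraph d L) J 2).symm.eq
  have hcharged : ∀ j ∈ u, Γ' (b j • W j) = C j * Wt j - Wt j * C j := by
    intro j hj
    rw [hC, hWt]
    simp only [Matrix.mul_smul, Matrix.smul_mul]
    rw [← smul_sub, hΓ', totalSpin_commutator_spinEmbed, hW j hj, map_smul, map_smul, smul_smul,
      div_mul_cancel₀ _ (hmq j hj)]
  -- residual
  have hMt : ∀ k ∈ w, (Γ' (M k)).IsContraction := fun k hk => isContraction_spinEmbed _ (hM k hk)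
  -- the identity on the torus
  have htorus : X - (c : ℂ) • (1 : Op (TorusSite d L) (n + 1)) =
      gramForm Λm (fun i => Γ' (O i)) +
        (∑ k ∈ s, (H * Γ' (spinEmbed (siteIncl (hB k)) (B k)) - Γ' (spinEmbed (siteIncl (hB k)) (B k)) * H) +
          ∑ l ∈ tt, (Us l * Yt l * (Us l)ᴴ - Yt l) +
          ∑ i ∈ (∅ : Finset (Fin 0)), ((0 : Op (TorusSite d L) (n + 1)) *
              ((0 : Op (TorusSite d L) (n + 1)) - (((0 : ℝ) : ℝ) : ℂ) • 1) +
            ((0 : Op (TorusSite d L) (n + 1)) - (((0 : ℝ) : ℝ) : ℂ) • 1) * (0 : Op (TorusSite d L) (n + 1))) +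
          ∑ j ∈ u, (C j * Wt j - Wt j * C j)) +
        (∑ m' ∈ ah, ((dc m' : ℝ) : ℂ) • ((Γ' (V m'))ᴴ - Γ' (V m')) + ∑ k ∈ w, a k • Γ' (M k)) := by
    have key := congrArg Γ' hcert
    rw [map_sub, map_smul Γ' ((c : ℝ) : ℂ) (1 : Op ↥Λ' (n + 1)), map_one] at key
    have h1 : Γ' (∑ k ∈ s, (heisenbergHamiltonian n (windowGraph Λ') J * spinEmbed (siteIncl (hB k)) (B k) -
        spinEmbed (siteIncl (hB k)) (B k) * heisenbergHamiltonian n (windowGraph Λ') J)) =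
        ∑ k ∈ s, (H * Γ' (spinEmbed (siteIncl (hB k)) (B k)) -
          Γ' (spinEmbed (siteIncl (hB k)) (B k)) * H) := by
      rw [map_sum]
      refine Finset.sum_congr rfl fun k _ => ?_
      rw [hH, hΓ', heisenbergTorus_commutator_spinEmbed n J (hB k) (hclosedB k) hInj (B k)]
    have h2 : Γ' (∑ l ∈ tt, D l) = ∑ l ∈ tt, (Us l * Yt l * (Us l)ᴴ - Yt l) := by
      rw [map_sum]
      refine Finset.sum_congr rfl fun l hl => ?_
      rw [hUs, hΓ']
      exact hD l hl
    have h3 : Γ' (∑ j ∈ u, b j • W j) = ∑ j ∈ u, (C j * Wt j - Wt j * C j) := by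
      rw [map_sum]
      exact Finset.sum_congr rfl hcharged
    have h4 : Γ' (∑ m' ∈ ah, ((dc m' : ℝ) : ℂ) • ((V m')ᴴ - V m')) =
        ∑ m' ∈ ah, ((dc m' : ℝ) : ℂ) • ((Γ' (V m'))ᴴ - Γ' (V m')) := by
      rw [map_sum]
      refine Finset.sum_congr rfl fun m' _ => ?_
      rw [map_smul, map_sub, hΓ', spinEmbed_conjTranspose]
    have h5 : Γ' (∑ k ∈ w, a k • M k) = ∑ k ∈ w, a k • Γ' (M k) := by
      rw [map_sum]
      exact Finset.sum_congr rfl fun k _ => by rw [map_smul]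
    rw [hX, key, map_add, map_add, map_add, map_add, map_add, hΓ', spinEmbed_gramForm, ← hΓ', h1, h2, h3,
      h4, h5, Finset.sum_empty, add_zero]
  have hmain := Matrix.mul_card_le_minEnergyOn_of_local_certificate hHh ⊤ (fun _ _ => Submodule.mem_top) hK
    X T hTH (fun _ _ _ => Submodule.mem_top) (fun _ _ _ => Submodule.mem_top) hTT hsum hΛm
    (fun i => Γ' (O i)) s (fun k => Γ' (spinEmbed (siteIncl (hB k)) (B k))) tt Us Yt hU
    (fun _ _ _ _ => Submodule.mem_top) (fun _ _ _ _ => Submodule.mem_top) hUU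
    (∅ : Finset (Fin 0)) (fun _ => 0) (fun _ => 0) (fun _ => 0) (fun _ => 0)
    (fun i hi => absurd hi (Finset.notMem_empty i)) (fun i hi => absurd hi (Finset.notMem_empty i))
    u C Wt hCH (fun _ _ _ _ => Submodule.mem_top) (fun _ _ _ _ => Submodule.mem_top)
    ah dc (fun m' => Γ' (V m')) w a (fun k => Γ' (M k)) hMt htorus
  rw [Literature.MathematicalPhysics.QuantumLattice.card_torusSite (d := d) (L := L), Nat.cast_pow,
    Matrix.minEnergyOn_top_holds hHh] at hmain
  exact hmain

end Workhorse

/-! ### `d = 2`: affine `D₄` reductions, per-term symmetry regions -/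

section D4

variable {L : ℕ} [NeZero L]

/-- **Window certificate with affine `D₄` reductions and PER-TERM regions ⇒ ground-state energy of
every large square Heisenberg torus.** As the tree's
`heisenbergSquare_groundEnergy_ge_of_window_certificate_d4`, but `Bₖ ∈ 𝔄(Λᴮₖ)` (`Λᴮₖ ⊆ Λ'`,
`Λᴮₖ ± eᵢ ⊆ Λ'`) and `Yₗ ∈ 𝔄(Λʸₗ)` (`Λʸₗ ⊆ Λ'`, `γₗ Λʸₗ + wₗ ⊆ Λ'`) term by term:
`(c − Σₖ ‖aₖ‖) · L² ≤ groundEnergy (heisenbergHamiltonian n (torusGraph 2 L) J)` for every `L ≥ 3` with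
`x ↦ x mod L` injective on `Λ'`. Han 2020 §3 (square-lattice constraints `T_(1,0), T_(0,1), Π, R`),
certified form. -/
theorem heisenbergSquare_groundEnergy_ge_of_window_certificate_d4_families (n : ℕ) (J : ℝ) (hL : 3 ≤ L)
    {Λ' : Finset (Site 2)}
    (hz : (0 : Site 2) ∈ Λ') (he : ∀ i : Fin 2, (unitVec i : Site 2) ∈ Λ')
    (hInj : Set.InjOn (Torus.proj (d := 2) L) ↑Λ')
    {m : Type*} [Fintype m] [DecidableEq m] {Λm : Matrix m m ℂ} (hΛm : Λm.PosSemidef)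
    (O : m → Op ↥Λ' (n + 1))
    {κ : Type*} (s : Finset κ) (ΛB : κ → Finset (Site 2)) (hB : ∀ k, ΛB k ⊆ Λ')
    (hclosedB : ∀ k, ∀ x ∈ ΛB k, ∀ i : Fin 2, x + unitVec i ∈ Λ' ∧ x - unitVec i ∈ Λ')
    (B : (k : κ) → Op ↥(ΛB k) (n + 1))
    {ι : Type*} (tt : Finset ι) (γ : ι → DihedralGroup 4) (wv : ι → Site 2)
    (ΛY : ι → Finset (Site 2)) (hY : ∀ l, ΛY l ⊆ Λ')
    (hsh : ∀ l, d4ShiftSet (γ l) (wv l) (ΛY l) ⊆ Λ') (Y : (l : ι) → Op ↥(ΛY l) (n + 1))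
    {ρ : Type*} (u : Finset ρ) (b : ρ → ℂ) (W : ρ → Op ↥Λ' (n + 1)) (mq : ρ → ℂ)
    (hmq : ∀ j ∈ u, mq j ≠ 0)
    (hW : ∀ j ∈ u, totalSpin n 2 * W j - W j * totalSpin n 2 = mq j • W j)
    {δ : Type*} (ah : Finset δ) (dc : δ → ℝ) (V : δ → Op ↥Λ' (n + 1))
    {κ'' : Type*} (w : Finset κ'') (a : κ'' → ℂ) (M : κ'' → Op ↥Λ' (n + 1))
    (hM : ∀ k ∈ w, (M k).IsContraction) {c : ℝ}
    (hcert : (J : ℂ) • (∑ i : Fin 2, spinDot n (⟨0, hz⟩ : ↥Λ') ⟨unitVec i, he i⟩) -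
        (c : ℂ) • (1 : Op ↥Λ' (n + 1)) =
      gramForm Λm O +
        (∑ k ∈ s, (heisenbergHamiltonian n (windowGraph Λ') J * spinEmbed (siteIncl (hB k)) (B k) -
            spinEmbed (siteIncl (hB k)) (B k) * heisenbergHamiltonian n (windowGraph Λ') J) +
          ∑ l ∈ tt, (spinEmbed (siteIncl (hsh l)) (spinEmbed (siteD4Emb (γ l) (wv l) (ΛY l)) (Y l)) -
            spinEmbed (siteIncl (hY l)) (Y l)) +
          ∑ j ∈ u, b j • W j) +
        (∑ m' ∈ ah, ((dc m' : ℝ) : ℂ) • ((V m')ᴴ - V m') + ∑ k ∈ w, a k • M k)) :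
    (c - ∑ k ∈ w, ‖a k‖) * (L : ℝ) ^ 2 ≤ (heisenbergHamiltonian n (torusGraph 2 L) J).groundEnergy :=
  heisenbergTorus_groundEnergy_ge_of_window_certificate_perm_families n J hL hz he hInj hΛm O s ΛB hB
    hclosedB B tt (fun l => torusD4Aff (γ l) (Torus.proj L (wv l)))
    (fun l _ x y => torusGraph_adj_torusD4Aff _ _ x y)
    (fun l => spinEmbed (siteIncl (hsh l)) (spinEmbed (siteD4Emb (γ l) (wv l) (ΛY l)) (Y l)) -
      spinEmbed (siteIncl (hY l)) (Y l))
    (fun l => spinEmbed (spinToTorusEmb L (hInj.mono (by exact_mod_cast hY l))) (Y l))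
    (fun l _ => spinEmbed_toTorus_d4_sub (hY l) (γ l) (wv l) (hsh l) hInj (Y l))
    u b W mq hmq hW ah dc V w a M hM hcert

/-- **Per-site form** (the shape of the bundle's square-torus-wise rows): with the data of
`heisenbergSquare_groundEnergy_ge_of_window_certificate_d4_families`,
`c − Σₖ ‖aₖ‖ ≤ groundEnergy (heisenbergHamiltonian n (torusGraph 2 L) J) / L²` for every `L ≥ 3` with
`x ↦ x mod L` injective on `Λ'`. -/
theorem heisenbergSquare_groundEnergy_div_ge_of_window_certificate_d4_families (n : ℕ) (J : ℝ)
    (hL : 3 ≤ L) {Λ' : Finset (Site 2)}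
    (hz : (0 : Site 2) ∈ Λ') (he : ∀ i : Fin 2, (unitVec i : Site 2) ∈ Λ')
    (hInj : Set.InjOn (Torus.proj (d := 2) L) ↑Λ')
    {m : Type*} [Fintype m] [DecidableEq m] {Λm : Matrix m m ℂ} (hΛm : Λm.PosSemidef)
    (O : m → Op ↥Λ' (n + 1))
    {κ : Type*} (s : Finset κ) (ΛB : κ → Finset (Site 2)) (hB : ∀ k, ΛB k ⊆ Λ')
    (hclosedB : ∀ k, ∀ x ∈ ΛB k, ∀ i : Fin 2, x + unitVec i ∈ Λ' ∧ x - unitVec i ∈ Λ')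
    (B : (k : κ) → Op ↥(ΛB k) (n + 1))
    {ι : Type*} (tt : Finset ι) (γ : ι → DihedralGroup 4) (wv : ι → Site 2)
    (ΛY : ι → Finset (Site 2)) (hY : ∀ l, ΛY l ⊆ Λ')
    (hsh : ∀ l, d4ShiftSet (γ l) (wv l) (ΛY l) ⊆ Λ') (Y : (l : ι) → Op ↥(ΛY l) (n + 1))
    {ρ : Type*} (u : Finset ρ) (b : ρ → ℂ) (W : ρ → Op ↥Λ' (n + 1)) (mq : ρ → ℂ)
    (hmq : ∀ j ∈ u, mq j ≠ 0)
    (hW : ∀ j ∈ u, totalSpin n 2 * W j - W j * totalSpin n 2 = mq j • W j)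
    {δ : Type*} (ah : Finset δ) (dc : δ → ℝ) (V : δ → Op ↥Λ' (n + 1))
    {κ'' : Type*} (w : Finset κ'') (a : κ'' → ℂ) (M : κ'' → Op ↥Λ' (n + 1))
    (hM : ∀ k ∈ w, (M k).IsContraction) {c : ℝ}
    (hcert : (J : ℂ) • (∑ i : Fin 2, spinDot n (⟨0, hz⟩ : ↥Λ') ⟨unitVec i, he i⟩) -
        (c : ℂ) • (1 : Op ↥Λ' (n + 1)) =
      gramForm Λm O +
        (∑ k ∈ s, (heisenbergHamiltonian n (windowGraph Λ') J * spinEmbed (siteIncl (hB k)) (B k) -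
            spinEmbed (siteIncl (hB k)) (B k) * heisenbergHamiltonian n (windowGraph Λ') J) +
          ∑ l ∈ tt, (spinEmbed (siteIncl (hsh l)) (spinEmbed (siteD4Emb (γ l) (wv l) (ΛY l)) (Y l)) -
            spinEmbed (siteIncl (hY l)) (Y l)) +
          ∑ j ∈ u, b j • W j) +
        (∑ m' ∈ ah, ((dc m' : ℝ) : ℂ) • ((V m')ᴴ - V m') + ∑ k ∈ w, a k • M k)) :
    c - ∑ k ∈ w, ‖a k‖ ≤
      (heisenbergHamiltonian n (torusGraph 2 L) J).groundEnergy / ((L : ℝ) ^ 2) := by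
  have hL0 : (0 : ℝ) < (L : ℝ) ^ 2 := pow_pos (by exact_mod_cast (show 0 < L by omega)) 2
  rw [le_div_iff₀ hL0]
  exact heisenbergSquare_groundEnergy_ge_of_window_certificate_d4_families n J hL hz he hInj hΛm O s ΛB hB
    hclosedB B tt γ wv ΛY hY hsh Y u b W mq hmq hW ah dc V w a M hM hcert

/-- **The support-box torus threshold (Heisenberg, square lattice).** As
`heisenbergSquare_groundEnergy_div_ge_of_window_certificate_d4_families`, with the injectivity of
`x ↦ x mod L` on `Λ'` replaced by the finite check that all coordinate spreads of `Λ'` are at most `M`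
together with `L ≥ M + 1` (`Torus.proj_injective_of_abs_sub_lt`). For `Λ'` the support box `B'` of a
reduce-mode certificate, of side `D'` (`M = D' − 1`): every `L ≥ max(3, D')`; the uniform threshold
`L ≥ D' + 2` of the cell's `certs/sdp1/SUPPORT-BOX.md` follows. -/
theorem heisenbergSquare_groundEnergy_div_ge_of_window_certificate_d4_families_of_spread (n : ℕ)
    (J : ℝ) (hL : 3 ≤ L) {M : ℕ} (hLM : M + 1 ≤ L) {Λ' : Finset (Site 2)}
    (hspread : ∀ x ∈ Λ', ∀ y ∈ Λ', ∀ j, |x j - y j| ≤ (M : ℤ))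
    (hz : (0 : Site 2) ∈ Λ') (he : ∀ i : Fin 2, (unitVec i : Site 2) ∈ Λ')
    {m : Type*} [Fintype m] [DecidableEq m] {Λm : Matrix m m ℂ} (hΛm : Λm.PosSemidef)
    (O : m → Op ↥Λ' (n + 1))
    {κ : Type*} (s : Finset κ) (ΛB : κ → Finset (Site 2)) (hB : ∀ k, ΛB k ⊆ Λ')
    (hclosedB : ∀ k, ∀ x ∈ ΛB k, ∀ i : Fin 2, x + unitVec i ∈ Λ' ∧ x - unitVec i ∈ Λ')
    (B : (k : κ) → Op ↥(ΛB k) (n + 1))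
    {ι : Type*} (tt : Finset ι) (γ : ι → DihedralGroup 4) (wv : ι → Site 2)
    (ΛY : ι → Finset (Site 2)) (hY : ∀ l, ΛY l ⊆ Λ')
    (hsh : ∀ l, d4ShiftSet (γ l) (wv l) (ΛY l) ⊆ Λ') (Y : (l : ι) → Op ↥(ΛY l) (n + 1))
    {ρ : Type*} (u : Finset ρ) (b : ρ → ℂ) (W : ρ → Op ↥Λ' (n + 1)) (mq : ρ → ℂ)
    (hmq : ∀ j ∈ u, mq j ≠ 0)
    (hW : ∀ j ∈ u, totalSpin n 2 * W j - W j * totalSpin n 2 = mq j • W j)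
    {δ : Type*} (ah : Finset δ) (dc : δ → ℝ) (V : δ → Op ↥Λ' (n + 1))
    {κ'' : Type*} (w : Finset κ'') (a : κ'' → ℂ) (M' : κ'' → Op ↥Λ' (n + 1))
    (hM : ∀ k ∈ w, (M' k).IsContraction) {c : ℝ}
    (hcert : (J : ℂ) • (∑ i : Fin 2, spinDot n (⟨0, hz⟩ : ↥Λ') ⟨unitVec i, he i⟩) -
        (c : ℂ) • (1 : Op ↥Λ' (n + 1)) =
      gramForm Λm O +
        (∑ k ∈ s, (heisenbergHamiltonian n (windowGraph Λ') J * spinEmbed (siteIncl (hB k)) (B k) -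
            spinEmbed (siteIncl (hB k)) (B k) * heisenbergHamiltonian n (windowGraph Λ') J) +
          ∑ l ∈ tt, (spinEmbed (siteIncl (hsh l)) (spinEmbed (siteD4Emb (γ l) (wv l) (ΛY l)) (Y l)) -
            spinEmbed (siteIncl (hY l)) (Y l)) +
          ∑ j ∈ u, b j • W j) +
        (∑ m' ∈ ah, ((dc m' : ℝ) : ℂ) • ((V m')ᴴ - V m') + ∑ k ∈ w, a k • M' k)) :
    c - ∑ k ∈ w, ‖a k‖ ≤
      (heisenbergHamiltonian n (torusGraph 2 L) J).groundEnergy / ((L : ℝ) ^ 2) := by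
  have hML : (M : ℤ) < L := by exact_mod_cast (show M < L by omega)
  have hInj : Set.InjOn (Torus.proj (d := 2) L) ↑Λ' := fun x hx y hy hxy =>
    Torus.proj_injective_of_abs_sub_lt (fun j => lt_of_le_of_lt (hspread x hx y hy j) hML) hxy
  exact heisenbergSquare_groundEnergy_div_ge_of_window_certificate_d4_families n J hL hz he hInj hΛm O s ΛB
    hB hclosedB B tt γ wv ΛY hY hsh Y u b W mq hmq hW ah dc V w a M' hM hcert

end D4

end Summit.HubbardSuperconductivity.ManyBodyBootstrap
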